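import Literature.RingTheory.MvPolynomial.FormalCubeIntegral
import Mathlib.MeasureTheory.Integral.Pi
import Mathlib.Analysis.SpecialFunctions.Integrals.Basic
import Mathlib.Topology.Algebra.MvPolynomial
import Mathlib.MeasureTheory.Function.LocallyIntegrable
import HarnessLib

/-!
# The formal cube integral is the Lebesgue integral over the unit cube

Topic `Literature/MeasureTheory/Integral`.  For `𝕜 = ℝ` or `ℂ` (any `RCLike` field) the formal
integration functional `Literature.RingTheory.MvPolynomial.cubeIntegral` on `MvPolynomial ι 𝕜`
(`t^d ↦ ∏ᵢ (dᵢ + 1)⁻¹`) is the honest integral of the polynomial function over the unit cube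
`[0,1]^ι` (`cubeIntegral_eq_setIntegral`): on monomials this is Fubini
(`MeasureTheory.integral_fintype_prod_eq_prod`) and `∫₀¹ tⁿ dt = (n+1)⁻¹`, and both sides are
linear.  Consequently the formal integral of a polynomial whose values on the cube are bounded is
bounded (`norm_cubeIntegral_le`), which is how the interpolation weights of the
Battle–Brydges–Federbush formula are estimated (`Literature/Probability/LatticeModels/
BattleFederbushWeights.lean`; Mastropietro 2008, (2.102)–(2.103); Benfatto–Giuliani–Mastropietro
2006, after (2.66): "`dP_T(t)` is a probability measure").  Everything is proved; no named fact.
[folklore]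
-/

noncomputable section

open MvPolynomial Finsupp _root_.MeasureTheory Literature.RingTheory.MvPolynomial

namespace Literature.MeasureTheory.Integral

variable {𝕜 : Type*} [RCLike 𝕜] {ι : Type*} [Fintype ι]

/-- The unit cube `[0,1]^ι`. [folklore] -/
def unitCube (ι : Type*) : Set (ι → ℝ) := Set.univ.pi fun _ => Set.Icc (0 : ℝ) 1

omit [Fintype ι] in
/-- Membership in the unit cube. [folklore] -/
theorem mem_unitCube {t : ι → ℝ} : t ∈ unitCube ι ↔ ∀ i, t i ∈ Set.Icc (0 : ℝ) 1 := by
  simp only [unitCube, Set.mem_univ_pi]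

omit [Fintype ι] in
/-- The unit cube is compact. [folklore] -/
theorem isCompact_unitCube : IsCompact (unitCube ι) := isCompact_univ_pi fun _ => isCompact_Icc

omit [Fintype ι] in
/-- The polynomial function `t ↦ p(t)` (real points, `𝕜`-coefficients) is continuous. [folklore] -/
theorem continuous_eval_ofReal (p : MvPolynomial ι 𝕜) :
    Continuous fun t : ι → ℝ => eval (fun i => (t i : 𝕜)) p :=
  (MvPolynomial.continuous_eval p).comp (continuous_pi fun i => RCLike.continuous_ofReal.comp (continuous_apply i))

/-- Polynomial functions are integrable on the unit cube. [folklore] -/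
theorem integrableOn_eval_unitCube (p : MvPolynomial ι 𝕜) :
    IntegrableOn (fun t : ι → ℝ => eval (fun i => (t i : 𝕜)) p) (unitCube ι) :=
  (continuous_eval_ofReal p).continuousOn.integrableOn_compact isCompact_unitCube

/-- `∫₀¹ tⁿ dt = (n + 1)⁻¹` (as a set integral over `[0,1]`, `𝕜`-valued). [folklore] -/
theorem setIntegral_Icc_pow (n : ℕ) :
    ∫ x in Set.Icc (0 : ℝ) 1, ((x : 𝕜) ^ n) = ((n : 𝕜) + 1)⁻¹ := by
  have h : ∫ x in Set.Icc (0 : ℝ) 1, ((x : 𝕜) ^ n) = ((∫ x in (0 : ℝ)..1, x ^ n : ℝ) : 𝕜) := by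
    simp_rw [← RCLike.ofReal_pow]
    rw [integral_ofReal, integral_Icc_eq_integral_Ioc, ← intervalIntegral.integral_of_le zero_le_one]
  rw [h, integral_pow]
  push_cast
  ring

/-- **The integral of a monomial over the unit cube**: `∫_{[0,1]^ι} a t^d dt = a ∏ᵢ (dᵢ + 1)⁻¹`.
[folklore] -/
theorem setIntegral_unitCube_monomial (d : ι →₀ ℕ) (a : 𝕜) :
    ∫ t in unitCube ι, eval (fun i => (t i : 𝕜)) (monomial d a) = a * (cubeWeight d : 𝕜) := by
  have he : ∀ t : ι → ℝ, eval (fun i => (t i : 𝕜)) (monomial d a) = a * ∏ i, (t i : 𝕜) ^ d i := by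
    intro t
    rw [eval_monomial, Finsupp.prod_fintype]
    exact fun i => pow_zero _
  simp_rw [he]
  rw [integral_const_mul]
  congr 1
  rw [unitCube, volume_pi, Measure.restrict_pi_pi,
    integral_fintype_prod_eq_prod (𝕜 := 𝕜) (fun i (x : ℝ) => (x : 𝕜) ^ d i), cubeWeight, Rat.cast_prod]
  refine Finset.prod_congr rfl fun i _ => ?_
  rw [setIntegral_Icc_pow]
  push_cast
  ring

/-- **The formal cube integral is the integral over the unit cube** (`𝕜 = ℝ, ℂ`):
`cubeIntegral p = ∫_{[0,1]^ι} p(t) dt`. [folklore] -/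
theorem cubeIntegral_eq_setIntegral (p : MvPolynomial ι 𝕜) :
    cubeIntegral ι 𝕜 p = ∫ t in unitCube ι, eval (fun i => (t i : 𝕜)) p := by
  induction p using MvPolynomial.induction_on' with
  | monomial d a =>
    rw [cubeIntegral_monomial, setIntegral_unitCube_monomial, eq_ratCast]
  | add p q hp hq =>
    rw [map_add, hp, hq, ← integral_add (integrableOn_eval_unitCube p) (integrableOn_eval_unitCube q)]
    simp only [map_add]

/-- The volume of the unit cube is `1`. [folklore] -/
theorem volume_unitCube : volume (unitCube ι) = 1 := by
  rw [unitCube, volume_pi, Measure.pi_pi]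
  simp

/-- **Bounding a formal cube integral by the values on the cube**: if `‖p(t)‖ ≤ C` on `[0,1]^ι`
then `‖cubeIntegral p‖ ≤ C`. [folklore] -/
theorem norm_cubeIntegral_le (p : MvPolynomial ι 𝕜) {C : ℝ}
    (hC : ∀ t ∈ unitCube ι, ‖eval (fun i => (t i : 𝕜)) p‖ ≤ C) : ‖cubeIntegral ι 𝕜 p‖ ≤ C := by
  rw [cubeIntegral_eq_setIntegral]
  have h := norm_setIntegral_le_of_norm_le_const (μ := volume) (s := unitCube ι)
    (by rw [volume_unitCube]; exact ENNReal.one_lt_top) hC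
  simpa only [measureReal_def, volume_unitCube, ENNReal.toReal_one, mul_one] using h

/-- **Positivity**: a polynomial nonnegative on the cube has nonnegative formal integral
(`𝕜 = ℝ`). [folklore] -/
theorem cubeIntegral_nonneg (p : MvPolynomial ι ℝ) (hp : ∀ t ∈ unitCube ι, 0 ≤ eval t p) :
    0 ≤ cubeIntegral ι ℝ p := by
  rw [cubeIntegral_eq_setIntegral]
  refine setIntegral_nonneg (MeasurableSet.univ_pi fun _ => measurableSet_Icc) fun t ht => ?_
  simpa using hp t ht

end Literature.MeasureTheory.Integral
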